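import Literature.Geometry.Riemannian.BaerHankeNormalForm
import Literature.Geometry.Lorentzian.MeanCurvatureRegularity
import Literature.Topology.FourManifolds.Gluing
import Summits.SmoothPoincare4.SmoothPoincare4.Theorems.WeylBudgetCorkRegluablePscStubSymmetricGluingOfBHData
import HarnessLib

/-!
# Stub `stub_swapSum` of line `swap-sum` (crux `CorkRegluablePsc`, stmt-SmoothPoincare4-3206) —
# steps (1)–(2): Bär–Hanke data for the Matveyev triple (`--supports` helper)

The registered stub `stub_swapSum` (skeleton `Cruxes/CorkRegluablePsc/Lines/swap_sum.lean`) is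
Matveyev's boundary-sum swap CARRIED OUT WITH METRICS: from a Matveyev triple
`S⁴ = W₁ ∪_{φ₁} M`, `Σ = W₂ ∪_{φ₂} M`, `D(W₁) = S⁴ = W₁ ∪_ψ W₂` (`ψ = φ₂⁻¹ ∘ φ₁`) and PSC metrics
`g₁, g₂, g_M` with ONE boundary metric and the one-sided corner inequalities
(i) `H₁ + H_M ∘ φ₁ ≥ 0`, (ii) `H₂ + H_M ∘ φ₂ ≥ 0`, (iii) `H₁ + H₂ ∘ ψ ≥ 0`, (iv) `H₁ ≥ 0`, produce
an involutive cork presentation with a τ-symmetric PSC germ.  Its printed recipe has four steps: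
(1) Bär–Hanke Prop. 28 + λ-selection, (2) Bär–Hanke Thm. 27 on the four pieces `W₁, W₂, M, W₁'`,
(3) two closed PSC gluings with isometric seam neighbourhoods, (4) the Gromov–Lawson connected sum
at a seam point with the swap involution.  This file PROVES steps (1) and (2):

* `swapSum_strictData_of_prop28` — step (1): Prop. 28 on the three pieces, continuity of the mean
  curvatures (`PseudoRiemannianMetric.contMDiff_meanCurvature`), and ONE smooth `μ : ∂W₁ → ℝ` with
  `max(-H_M' ∘ φ₁, -H₁') < 3μ < min(H₁', H₂' ∘ ψ)` (possible iff (i)–(iv);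
  `exists_contMDiff_invariant_between` with the identity), transported to `μ₂ = μ ∘ ψ⁻¹` on `∂W₂`
  and `μ_M = -μ ∘ φ₁⁻¹` on `∂M`; hence `3μ ≤ H₁'`, `3μ₂ ≤ H₂'`, `3μ_M ≤ H_M'`, `3(-μ) ≤ H₁'`;
* `swapSum_umbilicCollars_of_thm27` — step (2): Thm. 27 four times (parameters `μ, μ₂, μ_M, -μ`)
  with a common constant and a common collar width.

Steps (3), (4): `WeylBudgetCorkRegluablePscSwapSumGluedMetric.lean`,
`WeylBudgetCorkRegluablePscSwapSumTwinGluing.lean`, `WeylBudgetCorkRegluablePscStubSwapSum.lean`.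
Everything here is proved from the two Bär–Hanke named facts taken as hypotheses (both are
discharged in the tree: `BarHanke2023_thm27_umbilicNormalForm_holds`,
`BarHanke2023_prop28_meanCurvatureIncrease_holds`).  No `sorry`; axioms standard.

References: [BarHanke2023] §3 Def. 21, Thm. 27, Prop. 28 (arXiv:2012.09127 pp. 10–14);
[ONeill1983] Ch. 4 (shape tensor, mean curvature); [Matveyev1996] proof of part 2, p. 3.
-/

noncomputable section

-- `Summit.<Summit>.<Problem>`: for the single-conjunct summit the duplicate component is mandated.
set_option linter.dupNamespace false

open scoped Manifold ContDiff Topology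
open Set Function Filter

namespace Summit.SmoothPoincare4.SmoothPoincare4.Theorems

open Literature.Topology.FourManifolds Literature.Geometry.Lorentzian
  Literature.Geometry.Lorentzian.PseudoRiemannianMetric Literature.Geometry.Riemannian

/-! ### Step (1): Bär–Hanke Prop. 28 on the three pieces and the λ-selection -/

set_option maxHeartbeats 800000 in
/-- **Strict corner inequalities for the Matveyev triple and the warping functions.** Prop. 28
(`h28`, `m = 2`) on `(W₁, g₁, ν₁)`, `(W₂, g₂, ν₂)`, `(M, g_M, ν_M)` gives metrics with the same
boundary forms and unit normals and `H' = H + δ`, so that (i)–(iv) become strict; the `H'` are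
continuous (`PseudoRiemannianMetric.contMDiff_meanCurvature`); with `ψ = φ₂⁻¹ ∘ φ₁`,
`L := max(-H_M' ∘ φ₁, -H₁')/3 < U := min(H₁', H₂' ∘ ψ)/3` on the compact `∂W₁` (by (i)–(iv)), so
`exists_contMDiff_invariant_between` (with the identity as involution) gives a smooth `μ` with
`L < μ < U`; put `μ₂ := μ ∘ ψ⁻¹`, `μ_M := -μ ∘ φ₁⁻¹`.  Then `3μ ≤ H₁'`, `3μ₂ ≤ H₂'`, `3μ_M ≤ H_M'`
and `3(-μ) ≤ H₁'`. [cite: BarHanke2023, §3 Prop. 28] -/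
theorem swapSum_strictData_of_prop28 (h28 : BarHanke2023_prop28_meanCurvatureIncrease)
    {W₁ : Type} [TopologicalSpace W₁] [T2Space W₁] [SecondCountableTopology W₁] [CompactSpace W₁]
    [ChartedSpace (EuclideanHalfSpace 4) W₁] [IsManifold (𝓡∂ 4) ∞ W₁]
    (b₁ : BoundaryData (𝓡∂ 4) W₁ (𝓡 3))
    {W₂ : Type} [TopologicalSpace W₂] [T2Space W₂] [SecondCountableTopology W₂] [CompactSpace W₂]
    [ChartedSpace (EuclideanHalfSpace 4) W₂] [IsManifold (𝓡∂ 4) ∞ W₂]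
    (b₂ : BoundaryData (𝓡∂ 4) W₂ (𝓡 3))
    {M : Type} [TopologicalSpace M] [T2Space M] [SecondCountableTopology M] [CompactSpace M]
    [ChartedSpace (EuclideanHalfSpace 4) M] [IsManifold (𝓡∂ 4) ∞ M]
    (bM : BoundaryData (𝓡∂ 4) M (𝓡 3))
    (φ₁ : b₁.carrier ≃ₘ⟮𝓡 3, 𝓡 3⟯ bM.carrier) (φ₂ : b₂.carrier ≃ₘ⟮𝓡 3, 𝓡 3⟯ bM.carrier)
    (g₁ : PseudoRiemannianMetric (𝓡∂ 4) ∞ (EuclideanSpace ℝ (Fin 4)) (TangentSpace (𝓡∂ 4) : W₁ → Type _))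
    [g₁.HasLeviCivita] (hf₁ : g₁.IsSpacelikeImmersion (𝓡 3) b₁.incl) (ν₁ : NormalField (𝓡∂ 4) b₁.incl)
    (g₂ : PseudoRiemannianMetric (𝓡∂ 4) ∞ (EuclideanSpace ℝ (Fin 4)) (TangentSpace (𝓡∂ 4) : W₂ → Type _))
    [g₂.HasLeviCivita] (hf₂ : g₂.IsSpacelikeImmersion (𝓡 3) b₂.incl) (ν₂ : NormalField (𝓡∂ 4) b₂.incl)
    (gM : PseudoRiemannianMetric (𝓡∂ 4) ∞ (EuclideanSpace ℝ (Fin 4)) (TangentSpace (𝓡∂ 4) : M → Type _))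
    [gM.HasLeviCivita] (hfM : gM.IsSpacelikeImmersion (𝓡 3) bM.incl) (νM : NormalField (𝓡∂ 4) bM.incl)
    (hR₁ : g₁.IsRiemannian) (hS₁ : ∀ x, 0 < g₁.scalarCurvature x) (hU₁ : g₁.IsUnitNormal (𝓡 3) b₁.incl ν₁ 1)
    (hν₁ : ContMDiff (𝓡 3) (𝓡∂ 4).tangent ∞ (fun z ↦
      (Bundle.TotalSpace.mk' (EuclideanSpace ℝ (Fin 4)) (b₁.incl z) (ν₁ z) : TangentBundle (𝓡∂ 4) W₁)))
    (ho₁ : ∀ z, (show EuclideanSpace ℝ (Fin 4) from ν₁ z) 0 < 0)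
    (hR₂ : g₂.IsRiemannian) (hS₂ : ∀ x, 0 < g₂.scalarCurvature x) (hU₂ : g₂.IsUnitNormal (𝓡 3) b₂.incl ν₂ 1)
    (hν₂ : ContMDiff (𝓡 3) (𝓡∂ 4).tangent ∞ (fun w ↦
      (Bundle.TotalSpace.mk' (EuclideanSpace ℝ (Fin 4)) (b₂.incl w) (ν₂ w) : TangentBundle (𝓡∂ 4) W₂)))
    (ho₂ : ∀ w, (show EuclideanSpace ℝ (Fin 4) from ν₂ w) 0 < 0)
    (hRM : gM.IsRiemannian) (hSM : ∀ x, 0 < gM.scalarCurvature x) (hUM : gM.IsUnitNormal (𝓡 3) bM.incl νM 1)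
    (hνM : ContMDiff (𝓡 3) (𝓡∂ 4).tangent ∞ (fun m ↦
      (Bundle.TotalSpace.mk' (EuclideanSpace ℝ (Fin 4)) (bM.incl m) (νM m) : TangentBundle (𝓡∂ 4) M)))
    (hoM : ∀ m, (show EuclideanSpace ℝ (Fin 4) from νM m) 0 < 0)
    (hi : ∀ z, 0 ≤ g₁.meanCurvature b₁.incl contMDiff_pullbackBilin_holds hf₁ ν₁ z +
      gM.meanCurvature bM.incl contMDiff_pullbackBilin_holds hfM νM (φ₁ z))
    (hii : ∀ w, 0 ≤ g₂.meanCurvature b₂.incl contMDiff_pullbackBilin_holds hf₂ ν₂ w +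
      gM.meanCurvature bM.incl contMDiff_pullbackBilin_holds hfM νM (φ₂ w))
    (hiii : ∀ z, 0 ≤ g₁.meanCurvature b₁.incl contMDiff_pullbackBilin_holds hf₁ ν₁ z +
      g₂.meanCurvature b₂.incl contMDiff_pullbackBilin_holds hf₂ ν₂ (φ₂.symm (φ₁ z)))
    (hiv : ∀ z, 0 ≤ g₁.meanCurvature b₁.incl contMDiff_pullbackBilin_holds hf₁ ν₁ z) :
    ∃ (g₁' : PseudoRiemannianMetric (𝓡∂ 4) ∞ (EuclideanSpace ℝ (Fin 4)) (TangentSpace (𝓡∂ 4) : W₁ → Type _))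
      (_ : g₁'.HasLeviCivita) (hf₁' : g₁'.IsSpacelikeImmersion (𝓡 3) b₁.incl)
      (g₂' : PseudoRiemannianMetric (𝓡∂ 4) ∞ (EuclideanSpace ℝ (Fin 4)) (TangentSpace (𝓡∂ 4) : W₂ → Type _))
      (_ : g₂'.HasLeviCivita) (hf₂' : g₂'.IsSpacelikeImmersion (𝓡 3) b₂.incl)
      (gM' : PseudoRiemannianMetric (𝓡∂ 4) ∞ (EuclideanSpace ℝ (Fin 4)) (TangentSpace (𝓡∂ 4) : M → Type _))
      (_ : gM'.HasLeviCivita) (hfM' : gM'.IsSpacelikeImmersion (𝓡 3) bM.incl)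
      (μ₁ : b₁.carrier → ℝ) (μ₂ : b₂.carrier → ℝ) (μM : bM.carrier → ℝ),
      g₁'.IsRiemannian ∧ (∀ x, 0 < g₁'.scalarCurvature x) ∧ g₁'.IsUnitNormal (𝓡 3) b₁.incl ν₁ 1 ∧
      (∀ z, pullbackBilin (I := 𝓡∂ 4) (I' := 𝓡 3) b₁.incl g₁'.val z =
        pullbackBilin (I := 𝓡∂ 4) (I' := 𝓡 3) b₁.incl g₁.val z) ∧
      g₂'.IsRiemannian ∧ (∀ x, 0 < g₂'.scalarCurvature x) ∧ g₂'.IsUnitNormal (𝓡 3) b₂.incl ν₂ 1 ∧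
      (∀ w, pullbackBilin (I := 𝓡∂ 4) (I' := 𝓡 3) b₂.incl g₂'.val w =
        pullbackBilin (I := 𝓡∂ 4) (I' := 𝓡 3) b₂.incl g₂.val w) ∧
      gM'.IsRiemannian ∧ (∀ x, 0 < gM'.scalarCurvature x) ∧ gM'.IsUnitNormal (𝓡 3) bM.incl νM 1 ∧
      (∀ m, pullbackBilin (I := 𝓡∂ 4) (I' := 𝓡 3) bM.incl gM'.val m =
        pullbackBilin (I := 𝓡∂ 4) (I' := 𝓡 3) bM.incl gM.val m) ∧
      ContMDiff (𝓡 3) 𝓘(ℝ, ℝ) ∞ μ₁ ∧ ContMDiff (𝓡 3) 𝓘(ℝ, ℝ) ∞ μ₂ ∧ ContMDiff (𝓡 3) 𝓘(ℝ, ℝ) ∞ μM ∧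
      (∀ z, μ₂ ((φ₁.trans φ₂.symm) z) = μ₁ z) ∧ (∀ z, μM (φ₁ z) = -μ₁ z) ∧
      (∀ z, (((2 : ℕ) : ℝ) + 1) * μ₁ z ≤
        g₁'.meanCurvature b₁.incl contMDiff_pullbackBilin_holds hf₁' ν₁ z) ∧
      (∀ w, (((2 : ℕ) : ℝ) + 1) * μ₂ w ≤
        g₂'.meanCurvature b₂.incl contMDiff_pullbackBilin_holds hf₂' ν₂ w) ∧
      (∀ m, (((2 : ℕ) : ℝ) + 1) * μM m ≤
        gM'.meanCurvature bM.incl contMDiff_pullbackBilin_holds hfM' νM m) ∧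
      (∀ z, (((2 : ℕ) : ℝ) + 1) * (-μ₁ z) ≤
        g₁'.meanCurvature b₁.incl contMDiff_pullbackBilin_holds hf₁' ν₁ z) := by
  -- Bär–Hanke Prop. 28 on the three pieces: strict corner inequalities
  obtain ⟨δ₁, hδ₁, g₁', hL₁, hf₁', hR₁', hS₁', hU₁', hbd₁, hH₁⟩ :=
    h28 2 W₁ b₁ g₁ hf₁ ν₁ hR₁ hS₁ hU₁ hν₁ ho₁
  obtain ⟨δ₂, hδ₂, g₂', hL₂, hf₂', hR₂', hS₂', hU₂', hbd₂, hH₂⟩ :=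
    h28 2 W₂ b₂ g₂ hf₂ ν₂ hR₂ hS₂ hU₂ hν₂ ho₂
  obtain ⟨δM, hδM, gM', hLM, hfM', hRM', hSM', hUM', hbdM, hHM⟩ :=
    h28 2 M bM gM hfM νM hRM hSM hUM hνM hoM
  set H₁ : b₁.carrier → ℝ := fun z ↦
    g₁'.meanCurvature b₁.incl contMDiff_pullbackBilin_holds hf₁' ν₁ z with hH₁def
  set H₂ : b₂.carrier → ℝ := fun w ↦
    g₂'.meanCurvature b₂.incl contMDiff_pullbackBilin_holds hf₂' ν₂ w with hH₂def
  set HM : bM.carrier → ℝ := fun m ↦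
    gM'.meanCurvature bM.incl contMDiff_pullbackBilin_holds hfM' νM m with hHMdef
  -- continuity of the mean curvatures (O'Neill 1983, Ch. 4)
  have hc₁ : Continuous H₁ :=
    (g₁'.contMDiff_meanCurvature contMDiff_pullbackBilin_holds hf₁' ν₁ hν₁).continuous
  have hc₂ : Continuous H₂ :=
    (g₂'.contMDiff_meanCurvature contMDiff_pullbackBilin_holds hf₂' ν₂ hν₂).continuous
  have hcM : Continuous HM :=
    (gM'.contMDiff_meanCurvature contMDiff_pullbackBilin_holds hfM' νM hνM).continuous
  set ψ : b₁.carrier ≃ₘ⟮𝓡 3, 𝓡 3⟯ b₂.carrier := φ₁.trans φ₂.symm with hψ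
  have hψapp : ∀ z, ψ z = φ₂.symm (φ₁ z) := fun z ↦ rfl
  have hφ₂ψ : ∀ z, φ₂ (ψ z) = φ₁ z := fun z ↦ by
    rw [hψapp, Diffeomorph.apply_symm_apply]
  -- the four strict inequalities
  have hpa : ∀ z, 0 < H₁ z + HM (φ₁ z) := fun z ↦ by
    simp only [hH₁def, hHMdef, hH₁, hHM]; linarith [hi z]
  have hpb : ∀ z, 0 < H₂ (ψ z) + HM (φ₁ z) := fun z ↦ by
    have h := hii (ψ z)
    rw [hφ₂ψ] at h
    simp only [hH₂def, hHMdef, hH₂, hHM]; linarith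
  have hpc : ∀ z, 0 < H₁ z := fun z ↦ by
    simp only [hH₁def, hH₁]; linarith [hiv z]
  have hpd : ∀ z, 0 < H₁ z + H₂ (ψ z) := fun z ↦ by
    have h := hiii z
    simp only [hH₁def, hH₂def, hH₁, hH₂, hψapp]; linarith
  -- the boundary `∂W₁` is a compact Hausdorff 3-manifold
  haveI : T2Space b₁.carrier := b₁.isSmoothEmbedding.isEmbedding.t2Space
  haveI : CompactSpace b₁.carrier := by
    refine (Topology.IsClosedEmbedding.mk b₁.isSmoothEmbedding.isEmbedding ?_).compactSpace
    rw [b₁.range_incl]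
    exact ModelWithCorners.isClosed_boundary (I := 𝓡∂ 4) (M := W₁) (n := ∞) (by simp)
  -- λ-selection: a smooth `μ` with `L < μ < U`
  set Lf : b₁.carrier → ℝ := fun z ↦ max (-(HM (φ₁ z))) (-(H₁ z)) / 3 with hLfdef
  set Uf : b₁.carrier → ℝ := fun z ↦ min (H₁ z) (H₂ (ψ z)) / 3 with hUfdef
  have hLc : Continuous Lf :=
    ((hcM.comp φ₁.continuous).neg.max hc₁.neg).div_const 3
  have hUc : Continuous Uf := (hc₁.min (hc₂.comp ψ.continuous)).div_const 3
  have hLU : ∀ z, Lf z < Uf z := by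
    intro z
    have a1 := hpa z
    have a2 := hpb z
    have a3 := hpc z
    have a4 := hpd z
    simp only [hLfdef, hUfdef]
    rw [div_lt_div_iff_of_pos_right (by norm_num : (0:ℝ) < 3), max_lt_iff, lt_min_iff, lt_min_iff]
    exact ⟨⟨by linarith, by linarith⟩, ⟨by linarith, by linarith⟩⟩
  obtain ⟨μ, hμs, -, hμb⟩ := exists_contMDiff_invariant_between (Diffeomorph.refl (𝓡 3) b₁.carrier ∞)
    (fun z ↦ rfl) hLc hUc hLU (fun z ↦ rfl) (fun z ↦ rfl)
  -- the transported warping functions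
  obtain ⟨μ₂, hμ₂def⟩ : ∃ f : b₂.carrier → ℝ, ∀ w, f w = μ (ψ.symm w) := ⟨_, fun w ↦ rfl⟩
  obtain ⟨μM, hμMdef⟩ : ∃ f : bM.carrier → ℝ, ∀ m, f m = -μ (φ₁.symm m) := ⟨_, fun m ↦ rfl⟩
  have hμ₂s : ContMDiff (𝓡 3) 𝓘(ℝ, ℝ) ∞ μ₂ := by
    rw [show μ₂ = fun w ↦ μ (ψ.symm w) from funext hμ₂def]
    exact hμs.comp ψ.symm.contMDiff
  have hμMs : ContMDiff (𝓡 3) 𝓘(ℝ, ℝ) ∞ μM := by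
    rw [show μM = fun m ↦ -μ (φ₁.symm m) from funext hμMdef]
    exact (hμs.comp φ₁.symm.contMDiff).neg
  have hμ₂ψ : ∀ z, μ₂ (ψ z) = μ z := fun z ↦ by
    rw [hμ₂def, Diffeomorph.symm_apply_apply]
  have hμMφ : ∀ z, μM (φ₁ z) = -μ z := fun z ↦ by
    rw [hμMdef, Diffeomorph.symm_apply_apply]
  -- the four inequalities `3 μ ≤ H'`
  have hle₁ : ∀ z, (((2 : ℕ) : ℝ) + 1) * μ z ≤ H₁ z := fun z ↦ by
    have h1 := (hμb z).2
    have h2 : min (H₁ z) (H₂ (ψ z)) ≤ H₁ z := min_le_left _ _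
    simp only [hUfdef] at h1
    push_cast
    linarith
  have hle₂ : ∀ w, (((2 : ℕ) : ℝ) + 1) * μ₂ w ≤ H₂ w := fun w ↦ by
    rw [hμ₂def w]
    have h1 := (hμb (ψ.symm w)).2
    have h2 : min (H₁ (ψ.symm w)) (H₂ (ψ (ψ.symm w))) ≤ H₂ (ψ (ψ.symm w)) := min_le_right _ _
    rw [Diffeomorph.apply_symm_apply] at h2
    simp only [hUfdef, Diffeomorph.apply_symm_apply] at h1
    push_cast
    linarith
  have hleM : ∀ m, (((2 : ℕ) : ℝ) + 1) * μM m ≤ HM m := fun m ↦ by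
    rw [hμMdef m]
    have h1 := (hμb (φ₁.symm m)).1
    have h2 : -(HM (φ₁ (φ₁.symm m))) ≤ max (-(HM (φ₁ (φ₁.symm m)))) (-(H₁ (φ₁.symm m))) :=
      le_max_left _ _
    rw [Diffeomorph.apply_symm_apply] at h2
    simp only [hLfdef, Diffeomorph.apply_symm_apply] at h1
    push_cast
    linarith
  have hle₁' : ∀ z, (((2 : ℕ) : ℝ) + 1) * (-μ z) ≤ H₁ z := fun z ↦ by
    have h1 := (hμb z).1
    have h2 : -(H₁ z) ≤ max (-(HM (φ₁ z))) (-(H₁ z)) := le_max_right _ _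
    simp only [hLfdef] at h1
    push_cast
    linarith
  exact ⟨g₁', hL₁, hf₁', g₂', hL₂, hf₂', gM', hLM, hfM', μ, μ₂, μM, hR₁', hS₁', hU₁', hbd₁,
    hR₂', hS₂', hU₂', hbd₂, hRM', hSM', hUM', hbdM, hμs, hμ₂s, hμMs, hμ₂ψ, hμMφ, hle₁, hle₂,
    hleM, hle₁'⟩

/-! ### Step (2): Bär–Hanke Thm. 27 on the four pieces `W₁, W₂, M, W₁'` -/

set_option maxHeartbeats 800000 in
/-- **Umbilic `C₀`-normal collars on the four pieces.** Thm. 27 (`h27`, `m = 2`) on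
`(W₁, g₁, μ₁)`, `(W₂, g₂, μ₂)`, `(M, g_M, μ_M)` and on the SECOND COPY `(W₁, g₁, -μ₁)` (each with
`3μ ≤ H`), with the common constant (the max of the four `C₀`) and the common width (the min of
the four `ε₀`), gives four PSC metrics `ĝ₁, ĝ₂, ĝ_M, ĝ₁'` with unchanged boundary forms and collars
on which they are `ε² ds² + (1 - 2μ ε s - C₀ ε² s²) · incl^* ĝ` (parameters `μ₁, μ₂, μ_M, -μ₁`).
[cite: BarHanke2023, §3 Thm. 27 with Def. 21] -/
theorem swapSum_umbilicCollars_of_thm27 (h27 : BarHanke2023_thm27_umbilicNormalForm)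
    {W₁ : Type} [TopologicalSpace W₁] [T2Space W₁] [SecondCountableTopology W₁] [CompactSpace W₁]
    [ChartedSpace (EuclideanHalfSpace 4) W₁] [IsManifold (𝓡∂ 4) ∞ W₁]
    (b₁ : BoundaryData (𝓡∂ 4) W₁ (𝓡 3))
    {W₂ : Type} [TopologicalSpace W₂] [T2Space W₂] [SecondCountableTopology W₂] [CompactSpace W₂]
    [ChartedSpace (EuclideanHalfSpace 4) W₂] [IsManifold (𝓡∂ 4) ∞ W₂]
    (b₂ : BoundaryData (𝓡∂ 4) W₂ (𝓡 3))
    {M : Type} [TopologicalSpace M] [T2Space M] [SecondCountableTopology M] [CompactSpace M]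
    [ChartedSpace (EuclideanHalfSpace 4) M] [IsManifold (𝓡∂ 4) ∞ M]
    (bM : BoundaryData (𝓡∂ 4) M (𝓡 3))
    (g₁ : PseudoRiemannianMetric (𝓡∂ 4) ∞ (EuclideanSpace ℝ (Fin 4)) (TangentSpace (𝓡∂ 4) : W₁ → Type _))
    [g₁.HasLeviCivita] (hf₁ : g₁.IsSpacelikeImmersion (𝓡 3) b₁.incl) (ν₁ : NormalField (𝓡∂ 4) b₁.incl)
    (g₂ : PseudoRiemannianMetric (𝓡∂ 4) ∞ (EuclideanSpace ℝ (Fin 4)) (TangentSpace (𝓡∂ 4) : W₂ → Type _))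
    [g₂.HasLeviCivita] (hf₂ : g₂.IsSpacelikeImmersion (𝓡 3) b₂.incl) (ν₂ : NormalField (𝓡∂ 4) b₂.incl)
    (gM : PseudoRiemannianMetric (𝓡∂ 4) ∞ (EuclideanSpace ℝ (Fin 4)) (TangentSpace (𝓡∂ 4) : M → Type _))
    [gM.HasLeviCivita] (hfM : gM.IsSpacelikeImmersion (𝓡 3) bM.incl) (νM : NormalField (𝓡∂ 4) bM.incl)
    (μ₁ : b₁.carrier → ℝ) (μ₂ : b₂.carrier → ℝ) (μM : bM.carrier → ℝ)
    (hR₁ : g₁.IsRiemannian) (hS₁ : ∀ x, 0 < g₁.scalarCurvature x) (hU₁ : g₁.IsUnitNormal (𝓡 3) b₁.incl ν₁ 1)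
    (hν₁ : ContMDiff (𝓡 3) (𝓡∂ 4).tangent ∞ (fun z ↦
      (Bundle.TotalSpace.mk' (EuclideanSpace ℝ (Fin 4)) (b₁.incl z) (ν₁ z) : TangentBundle (𝓡∂ 4) W₁)))
    (ho₁ : ∀ z, (show EuclideanSpace ℝ (Fin 4) from ν₁ z) 0 < 0)
    (hR₂ : g₂.IsRiemannian) (hS₂ : ∀ x, 0 < g₂.scalarCurvature x) (hU₂ : g₂.IsUnitNormal (𝓡 3) b₂.incl ν₂ 1)
    (hν₂ : ContMDiff (𝓡 3) (𝓡∂ 4).tangent ∞ (fun w ↦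
      (Bundle.TotalSpace.mk' (EuclideanSpace ℝ (Fin 4)) (b₂.incl w) (ν₂ w) : TangentBundle (𝓡∂ 4) W₂)))
    (ho₂ : ∀ w, (show EuclideanSpace ℝ (Fin 4) from ν₂ w) 0 < 0)
    (hRM : gM.IsRiemannian) (hSM : ∀ x, 0 < gM.scalarCurvature x) (hUM : gM.IsUnitNormal (𝓡 3) bM.incl νM 1)
    (hνM : ContMDiff (𝓡 3) (𝓡∂ 4).tangent ∞ (fun m ↦
      (Bundle.TotalSpace.mk' (EuclideanSpace ℝ (Fin 4)) (bM.incl m) (νM m) : TangentBundle (𝓡∂ 4) M)))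
    (hoM : ∀ m, (show EuclideanSpace ℝ (Fin 4) from νM m) 0 < 0)
    (hμ₁s : ContMDiff (𝓡 3) 𝓘(ℝ, ℝ) ∞ μ₁) (hμ₂s : ContMDiff (𝓡 3) 𝓘(ℝ, ℝ) ∞ μ₂)
    (hμMs : ContMDiff (𝓡 3) 𝓘(ℝ, ℝ) ∞ μM)
    (hle₁ : ∀ z, (((2 : ℕ) : ℝ) + 1) * μ₁ z ≤
      g₁.meanCurvature b₁.incl contMDiff_pullbackBilin_holds hf₁ ν₁ z)
    (hle₂ : ∀ w, (((2 : ℕ) : ℝ) + 1) * μ₂ w ≤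
      g₂.meanCurvature b₂.incl contMDiff_pullbackBilin_holds hf₂ ν₂ w)
    (hleM : ∀ m, (((2 : ℕ) : ℝ) + 1) * μM m ≤
      gM.meanCurvature bM.incl contMDiff_pullbackBilin_holds hfM νM m)
    (hle₁' : ∀ z, (((2 : ℕ) : ℝ) + 1) * (-μ₁ z) ≤
      g₁.meanCurvature b₁.incl contMDiff_pullbackBilin_holds hf₁ ν₁ z) :
    ∃ (ĝ₁ : PseudoRiemannianMetric (𝓡∂ 4) ∞ (EuclideanSpace ℝ (Fin 4)) (TangentSpace (𝓡∂ 4) : W₁ → Type _))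
      (_ : ĝ₁.HasLeviCivita)
      (ĝ₂ : PseudoRiemannianMetric (𝓡∂ 4) ∞ (EuclideanSpace ℝ (Fin 4)) (TangentSpace (𝓡∂ 4) : W₂ → Type _))
      (_ : ĝ₂.HasLeviCivita)
      (ĝM : PseudoRiemannianMetric (𝓡∂ 4) ∞ (EuclideanSpace ℝ (Fin 4)) (TangentSpace (𝓡∂ 4) : M → Type _))
      (_ : ĝM.HasLeviCivita)
      (ĝ₁' : PseudoRiemannianMetric (𝓡∂ 4) ∞ (EuclideanSpace ℝ (Fin 4)) (TangentSpace (𝓡∂ 4) : W₁ → Type _))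
      (_ : ĝ₁'.HasLeviCivita) (C₀ ε : ℝ)
      (c₁ : b₁.Collar) (c₂ : b₂.Collar) (cM : bM.Collar) (c₁' : b₁.Collar),
      ĝ₁.IsRiemannian ∧ (∀ x, 0 < ĝ₁.scalarCurvature x) ∧
      ĝ₂.IsRiemannian ∧ (∀ x, 0 < ĝ₂.scalarCurvature x) ∧
      ĝM.IsRiemannian ∧ (∀ x, 0 < ĝM.scalarCurvature x) ∧
      ĝ₁'.IsRiemannian ∧ (∀ x, 0 < ĝ₁'.scalarCurvature x) ∧ 0 < ε ∧
      (∀ z, pullbackBilin (I := 𝓡∂ 4) (I' := 𝓡 3) b₁.incl ĝ₁.val z =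
        pullbackBilin (I := 𝓡∂ 4) (I' := 𝓡 3) b₁.incl g₁.val z) ∧
      (∀ w, pullbackBilin (I := 𝓡∂ 4) (I' := 𝓡 3) b₂.incl ĝ₂.val w =
        pullbackBilin (I := 𝓡∂ 4) (I' := 𝓡 3) b₂.incl g₂.val w) ∧
      (∀ m, pullbackBilin (I := 𝓡∂ 4) (I' := 𝓡 3) bM.incl ĝM.val m =
        pullbackBilin (I := 𝓡∂ 4) (I' := 𝓡 3) bM.incl gM.val m) ∧
      (∀ z, pullbackBilin (I := 𝓡∂ 4) (I' := 𝓡 3) b₁.incl ĝ₁'.val z =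
        pullbackBilin (I := 𝓡∂ 4) (I' := 𝓡 3) b₁.incl g₁.val z) ∧
      (∀ (p : b₁.carrier × Set.Icc (0 : ℝ) 1) (V V' : TangentSpace ((𝓡 3).prod (𝓡∂ 1)) p),
        pullbackBilin (I := 𝓡∂ 4) (I' := (𝓡 3).prod (𝓡∂ 1)) c₁ ĝ₁.val p V V' =
          ε ^ 2 * ((show EuclideanSpace ℝ (Fin 1) from V.2) 0 *
            (show EuclideanSpace ℝ (Fin 1) from V'.2) 0) +
          (1 - 2 * μ₁ p.1 * (ε * (p.2 : ℝ)) - C₀ * (ε * (p.2 : ℝ)) ^ 2) *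
            pullbackBilin (I := 𝓡∂ 4) (I' := 𝓡 3) b₁.incl ĝ₁.val p.1 V.1 V'.1) ∧
      (∀ (q : b₂.carrier × Set.Icc (0 : ℝ) 1) (V V' : TangentSpace ((𝓡 3).prod (𝓡∂ 1)) q),
        pullbackBilin (I := 𝓡∂ 4) (I' := (𝓡 3).prod (𝓡∂ 1)) c₂ ĝ₂.val q V V' =
          ε ^ 2 * ((show EuclideanSpace ℝ (Fin 1) from V.2) 0 *
            (show EuclideanSpace ℝ (Fin 1) from V'.2) 0) +
          (1 - 2 * μ₂ q.1 * (ε * (q.2 : ℝ)) - C₀ * (ε * (q.2 : ℝ)) ^ 2) *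
            pullbackBilin (I := 𝓡∂ 4) (I' := 𝓡 3) b₂.incl ĝ₂.val q.1 V.1 V'.1) ∧
      (∀ (r : bM.carrier × Set.Icc (0 : ℝ) 1) (V V' : TangentSpace ((𝓡 3).prod (𝓡∂ 1)) r),
        pullbackBilin (I := 𝓡∂ 4) (I' := (𝓡 3).prod (𝓡∂ 1)) cM ĝM.val r V V' =
          ε ^ 2 * ((show EuclideanSpace ℝ (Fin 1) from V.2) 0 *
            (show EuclideanSpace ℝ (Fin 1) from V'.2) 0) +
          (1 - 2 * μM r.1 * (ε * (r.2 : ℝ)) - C₀ * (ε * (r.2 : ℝ)) ^ 2) *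
            pullbackBilin (I := 𝓡∂ 4) (I' := 𝓡 3) bM.incl ĝM.val r.1 V.1 V'.1) ∧
      (∀ (p : b₁.carrier × Set.Icc (0 : ℝ) 1) (V V' : TangentSpace ((𝓡 3).prod (𝓡∂ 1)) p),
        pullbackBilin (I := 𝓡∂ 4) (I' := (𝓡 3).prod (𝓡∂ 1)) c₁' ĝ₁'.val p V V' =
          ε ^ 2 * ((show EuclideanSpace ℝ (Fin 1) from V.2) 0 *
            (show EuclideanSpace ℝ (Fin 1) from V'.2) 0) +
          (1 - 2 * (-μ₁ p.1) * (ε * (p.2 : ℝ)) - C₀ * (ε * (p.2 : ℝ)) ^ 2) *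
            pullbackBilin (I := 𝓡∂ 4) (I' := 𝓡 3) b₁.incl ĝ₁'.val p.1 V.1 V'.1) := by
  have hμ₁s' : ContMDiff (𝓡 3) 𝓘(ℝ, ℝ) ∞ (fun z ↦ -μ₁ z) := hμ₁s.neg
  obtain ⟨K₁, -, h27a⟩ := h27 2 W₁ b₁ g₁ hf₁ ν₁ μ₁ hR₁ hS₁ hU₁ hν₁ ho₁ hμ₁s hle₁
  obtain ⟨K₂, -, h27b⟩ := h27 2 W₂ b₂ g₂ hf₂ ν₂ μ₂ hR₂ hS₂ hU₂ hν₂ ho₂ hμ₂s hle₂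
  obtain ⟨K₃, -, h27c⟩ := h27 2 M bM gM hfM νM μM hRM hSM hUM hνM hoM hμMs hleM
  obtain ⟨K₄, -, h27d⟩ := h27 2 W₁ b₁ g₁ hf₁ ν₁ (fun z ↦ -μ₁ z) hR₁ hS₁ hU₁ hν₁ ho₁ hμ₁s' hle₁'
  set K : ℝ := max (max K₁ K₂) (max K₃ K₄) with hK
  have hK₁ : K₁ ≤ K := (le_max_left _ _).trans (le_max_left _ _)
  have hK₂ : K₂ ≤ K := (le_max_right _ _).trans (le_max_left _ _)
  have hK₃ : K₃ ≤ K := (le_max_left _ _).trans (le_max_right _ _)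
  have hK₄ : K₄ ≤ K := (le_max_right _ _).trans (le_max_right _ _)
  obtain ⟨ĝ₁, hL₁, ε₁, hR₁', hS₁', hbd₁, hε₁, hcol₁⟩ := h27a K hK₁
  obtain ⟨ĝ₂, hL₂, ε₂, hR₂', hS₂', hbd₂, hε₂, hcol₂⟩ := h27b K hK₂
  obtain ⟨ĝM, hLM, ε₃, hRM', hSM', hbdM, hε₃, hcolM⟩ := h27c K hK₃
  obtain ⟨ĝ₁', hL₁', ε₄, hR₁'', hS₁'', hbd₁', hε₄, hcol₁'⟩ := h27d K hK₄
  set ε : ℝ := min (min ε₁ ε₂) (min ε₃ ε₄) with hεdef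
  have hε : 0 < ε := lt_min (lt_min hε₁ hε₂) (lt_min hε₃ hε₄)
  have hε₁' : ε ≤ ε₁ := (min_le_left _ _).trans (min_le_left _ _)
  have hε₂' : ε ≤ ε₂ := (min_le_left _ _).trans (min_le_right _ _)
  have hε₃' : ε ≤ ε₃ := (min_le_right _ _).trans (min_le_left _ _)
  have hε₄' : ε ≤ ε₄ := (min_le_right _ _).trans (min_le_right _ _)
  -- (eliminate the collar existentials directly; plain `obtain` is markedly slower here)
  refine (hcol₁ ε hε hε₁').elim fun c₁ hc₁ ↦ ?_
  refine (hcol₂ ε hε hε₂').elim fun c₂ hc₂ ↦ ?_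
  refine (hcolM ε hε hε₃').elim fun cM hcM ↦ ?_
  refine (hcol₁' ε hε hε₄').elim fun c₁' hc₁' ↦ ?_
  refine ⟨ĝ₁, hL₁, ĝ₂, hL₂, ĝM, hLM, ĝ₁', hL₁', K, ε, c₁, c₂, cM, c₁', hR₁', hS₁', hR₂', hS₂',
    hRM', hSM', hR₁'', hS₁'', hε, hbd₁, hbd₂, hbdM, hbd₁', fun p V V' ↦ ?_, fun q V V' ↦ ?_,
    fun r V V' ↦ ?_, fun p V V' ↦ ?_⟩
  -- the normal forms, rewritten over the new metrics' own boundary forms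
  · rw [hc₁ p V V', hbd₁ p.1]
  · rw [hc₂ q V V', hbd₂ q.1]
  · rw [hcM r V V', hbdM r.1]
  · rw [hc₁' p V V', hbd₁' p.1]

end Summit.SmoothPoincare4.SmoothPoincare4.Theorems

end
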